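import Summits.Ventures.DiscreteObjects.Hadamard.FixedGramModP
import Summits.Ventures.DiscreteObjects.Hadamard.ElemAbelianRank2Small

/-!
# Hadamard 668 census, family F12 — `C₅ × C₅` and `C₃ × C₃`: the block fixed by the whole group has as many rows as
# columns, `|D| = |D'| ∈ {8, 18}` for `p = 5` and `|D| = |D'| ≡ 2 (mod 6)` for `p = 3` (kernel, structure)

Framing: lottery ticket; floor = certified bounds/negative ranges.

Cell pub-namedobj (venture DiscreteObjects), target (H), hadamard gen 18.  For two commuting signed automorphisms
`A = (α, α', d₁, e₁)`, `B = (β, β', d₂, e₂)` of exponent `p` of a Hadamard matrix let `D` (`D'`) be the rows (columns)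
fixed by both.  Gen 17 (`rank2_5_fixedAll`, `rank2_3_fixedAll`) gave `p²·|D'| ≤ 668` and `|D'| ≡ 668 (mod p)` from a
free row; the script-level survivor table (FAMILY-F12-G17 §7) has `|D| = |D'| ∈ {8, 18}` for `p = 5`.  This file puts
that header in the kernel with the mod-`p` fixed Gram matrix of `FixedGramModP`:
* `dvd_sum_not_fixedAll`: for commuting `σ, τ` of exponent `p` and a function invariant under both,
  `p ∣ Σ_{y ∉ Fix σ ∩ Fix τ} g(y)` [the part moved by `σ` (`dvd_sum_moved`) plus the part fixed by `σ` and moved by `τ`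
  (`dvd_sum_moved` for `τ` restricted to `Fix σ`)];
* `rank2_fixedAll_inner_dvd`: two distinct rows of `D` with equal `A`- and `B`-signs have inner product over `D'`
  divisible by `p` (row orthogonality + the previous lemma);
* `rank2_fixedAll_card_eq`: if `p ∤ |D|` and `p ∤ |D'|` then **`|D| = |D'|`** and `(|D'|)^|D|` is a square mod `p`
  (`card_le_card_of_inner_dvd` on `H` and on `Hᵀ`, `isSquare_pow_of_inner_dvd`; the signs of the rows of `D` are
  pinned by a column of `D'` via `signedAut_fixed_sign`);
* **`hadamard668_rank2_5_fixedAll_eq`**: for `C₅ × C₅` acting on an H(668) (hypotheses of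
  `no_hadamard668_elemAbelian_rank2_7` with `7 → 5`): `|D| = |D'| ∈ {8, 18}` — `3` dies because two rows of `D` would
  have an odd inner product over three columns divisible by `5`; `13`, `23` die as non-squares mod `5`;
* **`hadamard668_rank2_3_fixedAll_eq`**: for `C₃ × C₃`: `|D| = |D'|`, `|D'| ≡ 2 (mod 6)`, `|D'| ≤ 74`.
STRUCTURE only: neither group is excluded.  Ours, not literature; no `sorry`, no definitions, default heartbeats.
-/

namespace Summit.Ventures.DiscreteObjects.Hadamard

open Finset BigOperators Matrix

open Literature.Combinatorics.Designs.GoethalsSeidel (IsHadamardMatrix)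

variable {ι : Type*} [Fintype ι] [DecidableEq ι]

omit [Fintype ι] [DecidableEq ι] in
/-- invariance under `σ` gives invariance under all powers -/
lemma apply_pow_eq_of_invariant (σ : Equiv.Perm ι) (g : ι → ℤ) (hg : ∀ y, g (σ y) = g y) (k : ℕ) (y : ι) :
    g ((σ ^ k) y) = g y := by
  induction k with
  | zero => simp
  | succ k ih => rw [pow_succ', Equiv.Perm.mul_apply, hg, ih]

/-- **`p ∣ Σ_{y ∉ Fix σ ∩ Fix τ} g`** for commuting `σ, τ` of exponent `p` and `g` invariant under both. -/
theorem dvd_sum_not_fixedAll (σ τ : Equiv.Perm ι) {p : ℕ} (hp : p.Prime) (hσ : σ ^ p = 1) (hτ : τ ^ p = 1)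
    (hc : Commute σ τ) (g : ι → ℤ) (hgσ : ∀ y, g (σ y) = g y) (hgτ : ∀ y, g (τ y) = g y) :
    (p : ℤ) ∣ ∑ y ∈ univ.filter (fun y => ¬ (σ y = y ∧ τ y = y)), g y := by
  classical
  -- split: moved by σ, or fixed by σ and moved by τ
  have hset : (univ.filter fun y => ¬ (σ y = y ∧ τ y = y)) =
      (univ.filter fun y => σ y ≠ y) ∪ (univ.filter fun y => σ y = y ∧ τ y ≠ y) := by
    ext y; simp only [Finset.mem_filter, Finset.mem_univ, true_and, Finset.mem_union]; tauto
  have hdisj : Disjoint (univ.filter fun y => σ y ≠ y) (univ.filter fun y => σ y = y ∧ τ y ≠ y) := by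
    rw [Finset.disjoint_filter]; intro y _ h1 h2; exact h1 h2.1
  rw [hset, Finset.sum_union hdisj]
  apply dvd_add
  · exact dvd_sum_moved σ hp hσ g (fun y₀ _ i => apply_pow_eq_of_invariant σ g hgσ i y₀)
  · -- τ restricted to Fix σ
    have hinv : ∀ y, σ y = y ↔ σ (τ y) = τ y := by
      intro y
      have e1 : σ (τ y) = τ (σ y) := by
        have := congrArg (fun f : Equiv.Perm ι => f y) hc.eq
        simpa [Equiv.Perm.mul_apply] using this
      rw [e1]
      constructor
      · intro h; rw [h]
      · intro h; exact τ.injective h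
    have hinv' : ∀ y, σ (τ y) = τ y ↔ σ y = y := fun y => (hinv y).symm
    set ρ : Equiv.Perm {y // σ y = y} := τ.subtypePerm hinv' with hρ
    have hρp : ρ ^ p = 1 := by
      ext ⟨y, hy⟩
      have h1 : (((ρ ^ p) ⟨y, hy⟩ : {y // σ y = y}) : ι) = (τ ^ p) y := by
        rw [hρ, Equiv.Perm.subtypePerm_pow]; rfl
      rw [h1, hτ]; rfl
    have hsub := dvd_sum_moved ρ hp hρp (fun z => g z.1) (fun z₀ _ i => by
      show g (((ρ ^ i) z₀ : {y // σ y = y}) : ι) = g z₀.1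
      have : (((ρ ^ i) z₀ : {y // σ y = y}) : ι) = (τ ^ i) z₀.1 := by
        rw [hρ, Equiv.Perm.subtypePerm_pow]; rfl
      rw [this, apply_pow_eq_of_invariant τ g hgτ])
    have hset2 : (univ.filter fun y => σ y = y ∧ τ y ≠ y) =
        (univ.filter fun y => σ y = y).filter (fun y => τ y ≠ y) := by
      ext y; simp only [Finset.mem_filter, Finset.mem_univ, true_and]
    rw [hset2, Finset.sum_filter,
      Finset.sum_subtype (univ.filter fun y => σ y = y) (p := fun y => σ y = y) (fun y => by simp),
      ← Finset.sum_filter]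
    have e : (univ.filter fun z : {y // σ y = y} => τ z.1 ≠ z.1) = univ.filter fun z => ρ z ≠ z := by
      ext z
      simp only [Finset.mem_filter, Finset.mem_univ, true_and, hρ]
      rw [not_iff_not]
      constructor
      · intro h; exact Subtype.ext (by rw [Equiv.Perm.subtypePerm_apply]; exact h)
      · intro h; have := congrArg Subtype.val h; rw [Equiv.Perm.subtypePerm_apply] at this; exact this
    rw [e]
    exact hsub

section pair
variable {H : Matrix ι ι ℤ} {α α' β β' : Equiv.Perm ι} {d₁ e₁ d₂ e₂ : ι → ℤ}

/-- **(E3) for the group-fixed block**: two distinct rows fixed by `α` and `β`, with equal `A`-signs and equal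
`B`-signs, have inner product over the columns fixed by `α'` and `β'` divisible by `p`. -/
theorem rank2_fixedAll_inner_dvd (hH : IsHadamardMatrix H) (hA : IsSignedAut H α α' d₁ e₁)
    (hB : IsSignedAut H β β' d₂ e₂) {p : ℕ} (hp : p.Prime) (hα' : α' ^ p = 1) (hβ' : β' ^ p = 1)
    (hc' : Commute α' β') {x x' : ι} (hxx' : x ≠ x') (hxα : α x = x) (hxβ : β x = x) (hx'α : α x' = x')
    (hx'β : β x' = x') (hd₁ : d₁ x = d₁ x') (hd₂ : d₂ x = d₂ x') :
    (p : ℤ) ∣ ∑ y ∈ univ.filter (fun y => α' y = y ∧ β' y = y), H x y * H x' y := by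
  have horth : ∑ y, H x y * H x' y = 0 := hadamard_row_orth H hH hxx'
  have hsplit := Finset.sum_filter_add_sum_filter_not (univ : Finset ι) (fun y => α' y = y ∧ β' y = y)
    (fun y => H x y * H x' y)
  rw [horth] at hsplit
  have hinvA : ∀ y, H x (α' y) * H x' (α' y) = H x y * H x' y := by
    intro y
    have h1 := hA.2.2 x y; have h2 := hA.2.2 x' y
    rw [hxα] at h1; rw [hx'α] at h2
    rw [h1, h2, ← hd₁]
    have hd2 : d₁ x * d₁ x = 1 := pm_mul_self (hA.1 x)
    have he2 : e₁ y * e₁ y = 1 := pm_mul_self (hA.2.1 y)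
    calc d₁ x * e₁ y * H x y * (d₁ x * e₁ y * H x' y) = (d₁ x * d₁ x) * (e₁ y * e₁ y) * (H x y * H x' y) := by ring
      _ = H x y * H x' y := by rw [hd2, he2, one_mul, one_mul]
  have hinvB : ∀ y, H x (β' y) * H x' (β' y) = H x y * H x' y := by
    intro y
    have h1 := hB.2.2 x y; have h2 := hB.2.2 x' y
    rw [hxβ] at h1; rw [hx'β] at h2
    rw [h1, h2, ← hd₂]
    have hd2 : d₂ x * d₂ x = 1 := pm_mul_self (hB.1 x)
    have he2 : e₂ y * e₂ y = 1 := pm_mul_self (hB.2.1 y)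
    calc d₂ x * e₂ y * H x y * (d₂ x * e₂ y * H x' y) = (d₂ x * d₂ x) * (e₂ y * e₂ y) * (H x y * H x' y) := by ring
      _ = H x y * H x' y := by rw [hd2, he2, one_mul, one_mul]
  have hmoved := dvd_sum_not_fixedAll α' β' hp hα' hβ' hc' (fun y => H x y * H x' y) hinvA hinvB
  have : ∑ y ∈ univ.filter (fun y => α' y = y ∧ β' y = y), H x y * H x' y =
      -∑ y ∈ univ.filter (fun y => ¬ (α' y = y ∧ β' y = y)), H x y * H x' y := by linarith
  rw [this]
  exact (dvd_neg).mpr hmoved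

/-- **`|D| = |D'|` and `(|D'|)^|D|` is a square mod `p`** when `p ∤ |D|`, `p ∤ |D'|`, for two commuting signed
automorphisms of exponent `p` of a Hadamard matrix (`D`, `D'` = rows, columns fixed by both). -/
theorem rank2_fixedAll_card_eq (hH : IsHadamardMatrix H) (hA : IsSignedAut H α α' d₁ e₁)
    (hB : IsSignedAut H β β' d₂ e₂) {p : ℕ} (hp : p.Prime)
    (hα : α ^ p = 1) (hα' : α' ^ p = 1) (hβ : β ^ p = 1) (hβ' : β' ^ p = 1)
    (hc : Commute α β) (hc' : Commute α' β')
    (hD : ¬ p ∣ (univ.filter fun x => α x = x ∧ β x = x).card)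
    (hD' : ¬ p ∣ (univ.filter fun y => α' y = y ∧ β' y = y).card) :
    (univ.filter fun x => α x = x ∧ β x = x).card = (univ.filter fun y => α' y = y ∧ β' y = y).card ∧
      IsSquare ((((univ.filter fun y => α' y = y ∧ β' y = y).card : ℕ) : ZMod p) ^
        (univ.filter fun x => α x = x ∧ β x = x).card) := by
  have hDpos : 0 < (univ.filter fun x => α x = x ∧ β x = x).card := by
    rcases Nat.eq_zero_or_pos (univ.filter fun x => α x = x ∧ β x = x).card with h | h
    · rw [h] at hD; exact absurd (dvd_zero p) hD
    · exact h
  have hD'pos : 0 < (univ.filter fun y => α' y = y ∧ β' y = y).card := by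
    rcases Nat.eq_zero_or_pos (univ.filter fun y => α' y = y ∧ β' y = y).card with h | h
    · rw [h] at hD'; exact absurd (dvd_zero p) hD'
    · exact h
  have hcard : (Fintype.card ι : ℤ) ≠ 0 := by
    have : 0 < Fintype.card ι := lt_of_lt_of_le hDpos (Finset.card_le_univ _)
    exact_mod_cast this.ne'
  have hHt : IsHadamardMatrix Hᵀ := isHadamard_transpose hH hcard
  -- sign pinning by a common fixed column / row
  obtain ⟨j₀, hj₀⟩ := Finset.card_pos.mp hD'pos
  obtain ⟨i₀, hi₀⟩ := Finset.card_pos.mp hDpos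
  simp only [Finset.mem_filter, Finset.mem_univ, true_and] at hj₀ hi₀
  have hrows : ∀ x ∈ univ.filter (fun x => α x = x ∧ β x = x), ∀ x' ∈ univ.filter (fun x => α x = x ∧ β x = x),
      x ≠ x' → (p : ℤ) ∣ ∑ y ∈ univ.filter (fun y => α' y = y ∧ β' y = y), H x y * H x' y := by
    intro x hx x' hx' hxx'
    simp only [Finset.mem_filter, Finset.mem_univ, true_and] at hx hx'
    exact rank2_fixedAll_inner_dvd hH hA hB hp hα' hβ' hc' hxx' hx.1 hx.2 hx'.1 hx'.2
      (by rw [signedAut_fixed_sign hH.1 hA hx.1 hj₀.1, signedAut_fixed_sign hH.1 hA hx'.1 hj₀.1])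
      (by rw [signedAut_fixed_sign hH.1 hB hx.2 hj₀.2, signedAut_fixed_sign hH.1 hB hx'.2 hj₀.2])
  have hcols : ∀ y ∈ univ.filter (fun y => α' y = y ∧ β' y = y), ∀ y' ∈ univ.filter (fun y => α' y = y ∧ β' y = y),
      y ≠ y' → (p : ℤ) ∣ ∑ x ∈ univ.filter (fun x => α x = x ∧ β x = x), Hᵀ y x * Hᵀ y' x := by
    intro y hy y' hy' hyy'
    simp only [Finset.mem_filter, Finset.mem_univ, true_and] at hy hy'
    exact rank2_fixedAll_inner_dvd hHt (isSignedAut_transpose hA) (isSignedAut_transpose hB) hp hα hβ hc hyy'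
      hy.1 hy.2 hy'.1 hy'.2
      (by rw [← signedAut_fixed_sign hH.1 hA hi₀.1 hy.1, ← signedAut_fixed_sign hH.1 hA hi₀.1 hy'.1])
      (by rw [← signedAut_fixed_sign hH.1 hB hi₀.2 hy.2, ← signedAut_fixed_sign hH.1 hB hi₀.2 hy'.2])
  have hpmR : ∀ x ∈ univ.filter (fun x => α x = x ∧ β x = x), ∀ y ∈ univ.filter (fun y => α' y = y ∧ β' y = y),
      H x y = 1 ∨ H x y = -1 := fun x _ y _ => hH.1 x y
  have hpmC : ∀ y ∈ univ.filter (fun y => α' y = y ∧ β' y = y), ∀ x ∈ univ.filter (fun x => α x = x ∧ β x = x),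
      Hᵀ y x = 1 ∨ Hᵀ y x = -1 := fun y _ x _ => hH.1 x y
  have h1 := card_le_card_of_inner_dvd hp (fun x y => H x y) _ _ hpmR hrows hD'
  have h2 := card_le_card_of_inner_dvd hp (fun y x => Hᵀ y x) _ _ hpmC hcols hD
  have heq := le_antisymm h1 h2
  exact ⟨heq, isSquare_pow_of_inner_dvd (fun x y => H x y) _ _ hpmR hrows heq⟩

/-- **C₅ × C₅ on an H(668): `|D| = |D'| ∈ {8, 18}`.**  Hypotheses as `no_hadamard668_elemAbelian_rank2_7` with
`7 → 5` (two signed automorphisms of exponent `5`, commuting, independent on the rows); `D`, `D'` = rows, columns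
fixed by both.  Structure only; `C₅ × C₅` is not excluded. -/
theorem hadamard668_rank2_5_fixedAll_eq (hH : IsHadamardMatrix H) (hι : Fintype.card ι = 668)
    (hA : IsSignedAut H α α' d₁ e₁) (hB : IsSignedAut H β β' d₂ e₂)
    (hα : α ^ 5 = 1) (hα' : α' ^ 5 = 1) (hβ : β ^ 5 = 1) (hβ' : β' ^ 5 = 1)
    (hc : Commute α β) (hc' : Commute α' β')
    (hind : ∀ a b : ℕ, a < 5 → b < 5 → α ^ a * β ^ b = 1 → a = 0 ∧ b = 0) :
    (univ.filter fun x => α x = x ∧ β x = x).card = (univ.filter fun y => α' y = y ∧ β' y = y).card ∧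
    ((univ.filter fun y => α' y = y ∧ β' y = y).card = 8 ∨ (univ.filter fun y => α' y = y ∧ β' y = y).card = 18) := by
  classical
  haveI hp5 : Fact (Nat.Prime 5) := ⟨by norm_num⟩
  have hodd : Odd 5 := ⟨2, by norm_num⟩; have hcard : (Fintype.card ι : ℤ) ≠ 0 := by rw [hι]; norm_num
  have hHt : IsHadamardMatrix Hᵀ := isHadamard_transpose hH hcard
  have hne : ∀ g : Multiplicative (ZMod 5 × ZMod 5), g ≠ 1 → (α ^ (Multiplicative.toAdd g).1.val
      * β ^ (Multiplicative.toAdd g).2.val) ≠ 1 :=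
    fun g hg => pairPerm_ne_one 5 α β hind hg
  have hne' : ∀ g : Multiplicative (ZMod 5 × ZMod 5), g ≠ 1 → (α' ^ (Multiplicative.toAdd g).1.val
      * β' ^ (Multiplicative.toAdd g).2.val) ≠ 1 := by
    intro g hg h1
    have ht := isSignedAut_transpose (isSignedAut_mul (isSignedAut_pow hA (Multiplicative.toAdd g).1.val)
      (isSignedAut_pow hB (Multiplicative.toAdd g).2.val))
    rw [h1] at ht
    exact hne g hg (signedAut_snd_eq_one Hᵀ hHt hcard ht hodd (pairPerm_pow_p 5 α β hα hβ hc g))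
  obtain ⟨h25D', hmodD'⟩ := rank2_5_fixedAll hH hι hA hB hα hα' hβ hβ' hc hc' hne
  obtain ⟨h25D, hmodD⟩ := rank2_5_fixedAll hHt hι (isSignedAut_transpose hA) (isSignedAut_transpose hB)
    hα' hα hβ' hβ hc' hc hne'
  have hD : ¬ 5 ∣ (univ.filter fun x => α x = x ∧ β x = x).card := by omega
  have hD' : ¬ 5 ∣ (univ.filter fun y => α' y = y ∧ β' y = y).card := by omega
  obtain ⟨heq, hsq⟩ := rank2_fixedAll_card_eq hH hA hB hp5.out hα hα' hβ hβ' hc hc' hD hD'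
  refine ⟨heq, ?_⟩
  rw [heq] at hsq
  set c := (univ.filter fun y => α' y = y ∧ β' y = y).card with hcdef
  have hc26 : c ≤ 26 := by norm_num at h25D'; omega
  have hcases : c = 3 ∨ c = 8 ∨ c = 13 ∨ c = 18 ∨ c = 23 := by omega
  rcases hcases with h | h | h | h | h
  · -- c = 3: two distinct rows of D have an odd inner product over three columns divisible by 5
    exfalso
    have h2 : 1 < (univ.filter fun x => α x = x ∧ β x = x).card := by omega
    obtain ⟨x, hx, x', hx', hxx'⟩ := Finset.one_lt_card.mp h2
    have h0 : 0 < (univ.filter fun y => α' y = y ∧ β' y = y).card := by omega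
    obtain ⟨j₀, hj₀⟩ := Finset.card_pos.mp h0
    simp only [Finset.mem_filter, Finset.mem_univ, true_and] at hx hx' hj₀
    have hdvd := rank2_fixedAll_inner_dvd hH hA hB hp5.out hα' hβ' hc' hxx' hx.1 hx.2 hx'.1 hx'.2
      (by rw [signedAut_fixed_sign hH.1 hA hx.1 hj₀.1, signedAut_fixed_sign hH.1 hA hx'.1 hj₀.1])
      (by rw [signedAut_fixed_sign hH.1 hB hx.2 hj₀.2, signedAut_fixed_sign hH.1 hB hx'.2 hj₀.2])
    obtain ⟨m, hm, hsum⟩ := sum_pm_eq_card_sub_two_mul (univ.filter fun y => α' y = y ∧ β' y = y)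
      (fun y => H x y * H x' y)
      (fun y _ => by rcases hH.1 x y with h1 | h1 <;> rcases hH.1 x' y with h2 | h2 <;> simp [h1, h2])
    rw [hsum] at hdvd
    rw [← hcdef, h] at hm hdvd
    obtain ⟨k, hk⟩ := hdvd
    push_cast at hk
    omega
  · exact Or.inl h
  · exfalso; rw [h] at hsq; revert hsq; decide
  · exact Or.inr h
  · exfalso; rw [h] at hsq; revert hsq; decide

/-- **C₃ × C₃ on an H(668): `|D| = |D'|`, `|D'| ≡ 2 (mod 6)`, `|D'| ≤ 74`.**  Hypotheses as above with `5 → 3`.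
Structure only; `C₃ × C₃` is not excluded. -/
theorem hadamard668_rank2_3_fixedAll_eq (hH : IsHadamardMatrix H) (hι : Fintype.card ι = 668)
    (hA : IsSignedAut H α α' d₁ e₁) (hB : IsSignedAut H β β' d₂ e₂)
    (hα : α ^ 3 = 1) (hα' : α' ^ 3 = 1) (hβ : β ^ 3 = 1) (hβ' : β' ^ 3 = 1)
    (hc : Commute α β) (hc' : Commute α' β')
    (hind : ∀ a b : ℕ, a < 3 → b < 3 → α ^ a * β ^ b = 1 → a = 0 ∧ b = 0) :
    (univ.filter fun x => α x = x ∧ β x = x).card = (univ.filter fun y => α' y = y ∧ β' y = y).card ∧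
    (univ.filter fun y => α' y = y ∧ β' y = y).card % 6 = 2 ∧
    (univ.filter fun y => α' y = y ∧ β' y = y).card ≤ 74 := by
  classical
  haveI hp3 : Fact (Nat.Prime 3) := ⟨by norm_num⟩
  have hodd : Odd 3 := ⟨1, by norm_num⟩; have hcard : (Fintype.card ι : ℤ) ≠ 0 := by rw [hι]; norm_num
  have hHt : IsHadamardMatrix Hᵀ := isHadamard_transpose hH hcard
  have hne : ∀ g : Multiplicative (ZMod 3 × ZMod 3), g ≠ 1 → (α ^ (Multiplicative.toAdd g).1.val
      * β ^ (Multiplicative.toAdd g).2.val) ≠ 1 :=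
    fun g hg => pairPerm_ne_one 3 α β hind hg
  have hne' : ∀ g : Multiplicative (ZMod 3 × ZMod 3), g ≠ 1 → (α' ^ (Multiplicative.toAdd g).1.val
      * β' ^ (Multiplicative.toAdd g).2.val) ≠ 1 := by
    intro g hg h1
    have ht := isSignedAut_transpose (isSignedAut_mul (isSignedAut_pow hA (Multiplicative.toAdd g).1.val)
      (isSignedAut_pow hB (Multiplicative.toAdd g).2.val))
    rw [h1] at ht
    exact hne g hg (signedAut_snd_eq_one Hᵀ hHt hcard ht hodd (pairPerm_pow_p 3 α β hα hβ hc g))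
  obtain ⟨h9D', hmodD'⟩ := rank2_3_fixedAll hH hι hA hB hα hα' hβ hβ' hc hc' hne
  obtain ⟨h9D, hmodD⟩ := rank2_3_fixedAll hHt hι (isSignedAut_transpose hA) (isSignedAut_transpose hB)
    hα' hα hβ' hβ hc' hc hne'
  have hD : ¬ 3 ∣ (univ.filter fun x => α x = x ∧ β x = x).card := by omega
  have hD' : ¬ 3 ∣ (univ.filter fun y => α' y = y ∧ β' y = y).card := by omega
  obtain ⟨heq, hsq⟩ := rank2_fixedAll_card_eq hH hA hB hp3.out hα hα' hβ hβ' hc hc' hD hD'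
  rw [heq] at hsq
  set c := (univ.filter fun y => α' y = y ∧ β' y = y).card with hcdef
  have hc74 : c ≤ 74 := by norm_num at h9D'; omega
  have hcast : ((c : ℕ) : ZMod 3) = 2 := by
    have : ((c : ℕ) : ZMod 3) = ((c % 3 : ℕ) : ZMod 3) := by rw [ZMod.natCast_mod]
    rw [this, hmodD']; rfl
  rw [hcast] at hsq
  have heven : c % 2 = 0 := by
    by_contra hodd'
    exact not_isSquare_two_pow_odd_mod3 (by omega) hsq
  exact ⟨heq, by omega, hc74⟩

end pair

end Summit.Ventures.DiscreteObjects.Hadamard
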